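import Literature.Barriers.PneNP.TSPExtensionComplexityRothvossGood
import Literature.Barriers.PneNP.TSPExtensionComplexityEntropy
import Literature.Barriers.PneNP.TSPExtensionComplexityRothvossAveraging
import Mathlib.Analysis.SpecialFunctions.Pow.Real
import HarnessLib

/-!
# Rothvoß's Lemma 14: few partitions of a fibre are `U`-bad

Support file for the discharge of `Literature.Barriers.PneNP.Rothvoss2017_tsp`. For a fixed pair
`(U*, M*) ∈ Q_3` let `𝒫(U*, M*)` be the partitions `T` compatible with it (the `(U*, M*)`-fibre of
the sample space `Ω_3` of `…RothvossSampling.lean`). Rothvoß's Lemma 14 (PDF p. 11): at most an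
`ε/2`-fraction of `T ∈ 𝒫(U*, M*)` is *`U`-bad* (neither SMALL nor `U`-good). The printed proof
re-samples `T` in two phases; we realise the second phase by the involutions
`T ↦ swap_i(T)` exchanging the rôles of the block `C ∖ U*` and of an `A`-block `A_i` outside
`U*` (`swapLab`): every `T ∈ 𝒫(U*, M*)` lies in the family `{swap_ℓ(T) : ℓ ∈ Lout(T)}` of
`(m+1)/2` compatible partitions (itself and one per outside `A`-block), the relation is symmetric,
and so `((m+1)/2) · #{bad T} = Σ_T #{ℓ ∈ Lout(T) : swap_ℓ(T) bad}` (double counting,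
`sum_card_bad_family_eq`). For a fixed `T` the cuts of all members of its family are read off one
cube `{0,1}^{m+1}` indexed by the `m + 1` blocks `C ∖ U*, A_1, …, A_m` (`cubeU`), and Rothvoß's
Lemma 10 (`card_biased_mul_le_log` of `…Entropy.lean`, `q = 2`) bounds the number of biased =
possibly-bad members (`card_bad_family_le`).

Sources: [Rothvoss2017] §3.5 (Def. 3, Lemma 10, Cor. 12; PDF pp. 10–11), §3.6 (Lemma 13,
Lemma 14; PDF pp. 11–12).
-/

noncomputable section

namespace Literature.Barriers.PneNP

open Finset Literature.Combinatorics.SimpleGraph.CycleSpace Lbl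

variable {n m k : ℕ}

/-! ### The fibre `𝒫(U*, M*)` -/

section Fibre

variable (n m k) in
/-- `𝒫(U*, M*)`: the partitions compatible with the pair `(U*, M*)`, i.e. the `(U*, M*)`-fibre of
`Ω_3`. [cite: Rothvoss2017, §3.6 (PDF p. 11: "T ∼ 𝒫(U, M)")] -/
def Pfib (t : ℕ) (U₀ : Finset (Fin n)) (M₀ : Finset (Sym2 (Fin n))) : Finset (Fin n → Lbl m) :=
  (partitions n m k).filter fun lab => M₀.filter (IsCD lab) ∈ cdMatchings lab 3 ∧
    U₀ ∈ Uext lab t (M₀.filter (IsCD lab)) ∧ M₀ ∈ Mext lab (M₀.filter (IsCD lab))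

variable {t : ℕ} {U₀ : Finset (Fin n)} {M₀ : Finset (Sym2 (Fin n))} {lab : Fin n → Lbl m}

/-- Membership in the fibre. [folklore] -/
theorem mem_Pfib_iff : lab ∈ Pfib n m k t U₀ M₀ ↔ lab ∈ partitions n m k ∧
    M₀.filter (IsCD lab) ∈ cdMatchings lab 3 ∧ U₀ ∈ Uext lab t (M₀.filter (IsCD lab)) ∧
    M₀ ∈ Mext lab (M₀.filter (IsCD lab)) := by
  rw [Pfib, mem_filter]

/-- The `(U*, M*)`-fibre of `Ω_3`, filtered by a property of `(T, H)`, is counted by the fibre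
`𝒫(U*, M*)`. [folklore] -/
theorem card_Omega_fibre_filter_eq (B : (Fin n → Lbl m) → Finset (Sym2 (Fin n)) → Prop)
    [∀ lab H, Decidable (B lab H)] :
    ((Omega n m k t 3).filter fun ω => (ω.2.1 = U₀ ∧ ω.2.2 = M₀) ∧
        B ω.1 (ω.2.2.filter (IsCD ω.1))).card =
      ((Pfib n m k t U₀ M₀).filter fun lab => B lab (M₀.filter (IsCD lab))).card := by
  classical
  symm
  refine card_nbij' (fun lab => (lab, U₀, M₀)) (fun ω => ω.1) (fun lab hlab => ?_) (fun ω hω => ?_)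
    (fun lab _ => rfl) (fun ω hω => ?_)
  · rw [mem_coe, mem_filter, mem_Pfib_iff] at hlab
    rw [mem_coe, mem_filter, mem_Omega_iff]
    exact ⟨hlab.1, ⟨rfl, rfl⟩, hlab.2⟩
  · rw [mem_coe, mem_filter, mem_Omega_iff] at hω
    rw [mem_coe, mem_filter, mem_Pfib_iff]
    obtain ⟨hΩ, ⟨h1, h2⟩, hB⟩ := hω
    subst h1; subst h2
    exact ⟨hΩ, hB⟩
  · rw [mem_coe, mem_filter] at hω
    obtain ⟨-, ⟨h1, h2⟩, -⟩ := hω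
    rcases ω with ⟨lab, U, M⟩
    simp only at h1 h2 ⊢
    rw [h1, h2]

/-- The `(U*, M*)`-fibre of `Ω_3` is counted by `𝒫(U*, M*)`. [folklore] -/
theorem card_Omega_fibre_eq :
    ((Omega n m k t 3).filter fun ω => ω.2.1 = U₀ ∧ ω.2.2 = M₀).card = (Pfib n m k t U₀ M₀).card := by
  classical
  have h := card_Omega_fibre_filter_eq (n := n) (m := m) (k := k) (t := t) (U₀ := U₀) (M₀ := M₀)
    (fun _ _ => True)
  simp only [and_true, filter_true_of_mem (fun _ _ => trivial)] at h
  exact h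

/-! Unpacking membership in the fibre. -/

/-- The facts packed in `T ∈ 𝒫(U*, M*)`. [folklore] -/
theorem Pfib_parts (h : lab ∈ Pfib n m k t U₀ M₀) :
    lab ∈ partitions n m k ∧ M₀.filter (IsCD lab) ∈ cdMatchings lab 3 ∧
      U₀ ∈ Uall lab t ∧ U₀ ∩ lblk lab Lbl.C = cov lab (M₀.filter (IsCD lab)) ∧
      IsPMOn (univ : Finset (Fin n)) M₀ ∧ (∀ e ∈ M₀, EResp lab e) := by
  obtain ⟨hP, hH, hU, hM⟩ := mem_Pfib_iff.1 h
  obtain ⟨hUall, hUC⟩ := mem_Uext_iff.1 hU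
  obtain ⟨hMall, -⟩ := mem_Mext_iff.1 hM
  obtain ⟨hPM, hresp⟩ := mem_Mall_iff.1 hMall
  exact ⟨hP, hH, hUall, hUC, hPM, hresp⟩

/-- In the fibre, `V(H) ∩ C ⊆ U*`. [folklore] -/
theorem Pfib_cov_subset (h : lab ∈ Pfib n m k t U₀ M₀) : cov lab (M₀.filter (IsCD lab)) ⊆ U₀ := by
  rw [← (Pfib_parts h).2.2.2.1]; exact inter_subset_left

/-- In the fibre, a `C`-labelled end of a `C`–`D` edge of `M*` lies in `U*`. [folklore] -/
theorem Pfib_mem_of_isCD (h : lab ∈ Pfib n m k t U₀ M₀) {e : Sym2 (Fin n)} (he : e ∈ M₀)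
    (hcd : IsCD lab e) {u : Fin n} (hu : u ∈ e) (hC : lab u = Lbl.C) : u ∈ U₀ :=
  (Pfib_cov_subset h) (mem_cov_iff.2 ⟨hC, e, mem_filter.2 ⟨he, hcd⟩, hu⟩)

/-- In the fibre, the vertices of `U*` carry labels `A_i` or `C`. [folklore] -/
theorem Pfib_isAC (h : lab ∈ Pfib n m k t U₀ M₀) {v : Fin n} (hv : v ∈ U₀) : (lab v).isAC = true :=
  (mem_Uall_iff.1 (Pfib_parts h).2.2.1).2.1 v hv

/-- In the fibre, `U*` is a union of whole `A`-blocks. [folklore] -/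
theorem Pfib_whole (h : lab ∈ Pfib n m k t U₀ M₀) {u : Fin n} (hu : u ∈ U₀) {i : Fin m}
    (hui : lab u = Lbl.A i) {v : Fin n} (hv : lab v = Lbl.A i) : v ∈ U₀ :=
  (mem_Uall_iff.1 (Pfib_parts h).2.2.1).2.2 u hu v (by rw [hv, hui]) (by rw [hui]; rfl)

/-- In the fibre, a `C`-labelled vertex of `U*` is covered by `H`: an `M*`-edge at it is a
`C`–`D` edge. [folklore] -/
theorem Pfib_isCD_of_mem (h : lab ∈ Pfib n m k t U₀ M₀) {u : Fin n} (hu : u ∈ U₀) (hC : lab u = Lbl.C)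
    {e : Sym2 (Fin n)} (he : e ∈ M₀) (hue : u ∈ e) : IsCD lab e := by
  have hcov : u ∈ cov lab (M₀.filter (IsCD lab)) := by
    rw [← (Pfib_parts h).2.2.2.1]; exact mem_inter.2 ⟨hu, mem_lblk.2 hC⟩
  obtain ⟨-, e', he', hue'⟩ := mem_cov_iff.1 hcov
  obtain ⟨he'M, hcd⟩ := mem_filter.1 he'
  rwa [(Pfib_parts h).2.2.2.2.1.unique he he'M hue hue']

end Fibre

/-! ### The swap `A_i ↔ C` outside `U*` -/

section Swap

variable (U₀ : Finset (Fin n))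

/-- **The re-randomisation step**: exchange the labels `A_i` and `C` outside `U*` (so the block
`C ∖ U*` becomes `A_i` and `A_i` joins `C`). [cite: Rothvoss2017, proof of Lemma 14 (PDF pp. 11–12: "C := H_C ∪ Ã_i")] -/
def swapLab (i : Fin m) (lab : Fin n → Lbl m) : Fin n → Lbl m :=
  fun v => if v ∈ U₀ then lab v else Equiv.swap (Lbl.A i) Lbl.C (lab v)

/-- The family index `none` is the partition itself, `some i` the swap with `A_i`. [folklore] -/
def swapO : Option (Fin m) → (Fin n → Lbl m) → (Fin n → Lbl m)
  | none => id
  | some i => swapLab U₀ i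

variable {U₀} {i : Fin m} {lab : Fin n → Lbl m} {v : Fin n}

/-- `swapLab` inside `U*`. [folklore] -/
@[simp] theorem swapLab_of_mem (h : v ∈ U₀) : swapLab U₀ i lab v = lab v := if_pos h

/-- `swapLab` outside `U*`. [folklore] -/
@[simp] theorem swapLab_of_not_mem (h : v ∉ U₀) :
    swapLab U₀ i lab v = Equiv.swap (Lbl.A i) Lbl.C (lab v) := if_neg h

/-- `swapLab` is an involution. [folklore] -/
@[simp] theorem swapLab_swapLab : swapLab U₀ i (swapLab U₀ i lab) = lab := by
  funext v
  by_cases h : v ∈ U₀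
  · simp [h]
  · simp [h, Equiv.swap_apply_self]

/-- `swapO none = id`. [folklore] -/
@[simp] theorem swapO_none : swapO U₀ none lab = lab := rfl

/-- `swapO (some i) = swapLab i`. [folklore] -/
@[simp] theorem swapO_some : swapO U₀ (some i) lab = swapLab U₀ i lab := rfl

/-- `swapO ℓ` is an involution. [folklore] -/
@[simp] theorem swapO_swapO : ∀ ℓ : Option (Fin m), swapO U₀ ℓ (swapO U₀ ℓ lab) = lab
  | none => rfl
  | some _ => swapLab_swapLab

/-- Labels other than `A_i`, `C` are untouched. [folklore] -/
theorem swapLab_eq_iff_of_ne {ℓ : Lbl m} (hA : ℓ ≠ Lbl.A i) (hC : ℓ ≠ Lbl.C) :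
    swapLab U₀ i lab v = ℓ ↔ lab v = ℓ := by
  by_cases h : v ∈ U₀
  · rw [swapLab_of_mem h]
  · rw [swapLab_of_not_mem h, Equiv.swap_apply_eq_iff, Equiv.swap_apply_of_ne_of_ne hA hC]

/-- The new `C`-block: `(U* ∩ C) ∪ A_i`. [cite: Rothvoss2017, proof of Lemma 14 (PDF p. 12: "C := H_C ∪ Ã_i")] -/
theorem lblk_swapLab_C (hi : Disjoint (lblk lab (Lbl.A i)) U₀) :
    lblk (swapLab U₀ i lab) Lbl.C = (U₀ ∩ lblk lab Lbl.C) ∪ lblk lab (Lbl.A i) := by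
  ext v
  simp only [mem_lblk, mem_union, mem_inter]
  by_cases hv : v ∈ U₀
  · rw [swapLab_of_mem hv]
    constructor
    · intro h; exact Or.inl ⟨hv, h⟩
    · rintro (⟨-, h⟩ | h)
      · exact h
      · exact absurd hv (disjoint_left.1 hi (mem_lblk.2 h))
  · rw [swapLab_of_not_mem hv, Equiv.swap_apply_eq_iff, Equiv.swap_apply_right]
    constructor
    · intro h; exact Or.inr h
    · rintro (⟨h, -⟩ | h)
      · exact absurd h hv
      · exact h

/-- The new `A_i`-block: `C ∖ U*`. [cite: Rothvoss2017, proof of Lemma 14 (PDF p. 12)] -/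
theorem lblk_swapLab_A (hi : Disjoint (lblk lab (Lbl.A i)) U₀) :
    lblk (swapLab U₀ i lab) (Lbl.A i) = lblk lab Lbl.C \ U₀ := by
  ext v
  simp only [mem_lblk, mem_sdiff]
  by_cases hv : v ∈ U₀
  · rw [swapLab_of_mem hv]
    constructor
    · intro h; exact absurd hv (disjoint_left.1 hi (mem_lblk.2 h))
    · rintro ⟨-, h⟩; exact absurd hv h
  · rw [swapLab_of_not_mem hv, Equiv.swap_apply_eq_iff, Equiv.swap_apply_left]
    exact ⟨fun h => ⟨h, hv⟩, fun h => h.1⟩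

/-- The other blocks are unchanged. [folklore] -/
theorem lblk_swapLab_of_ne {ℓ : Lbl m} (hA : ℓ ≠ Lbl.A i) (hC : ℓ ≠ Lbl.C) :
    lblk (swapLab U₀ i lab) ℓ = lblk lab ℓ := by
  ext v
  simp only [mem_lblk, swapLab_eq_iff_of_ne hA hC]

/-- Two distinct labels with the same edge class are `C` and `D`. [folklore] -/
theorem cls_eq_cls_of_ne {x y : Lbl m} (h : cls x = cls y) (hne : x ≠ y) :
    (x = Lbl.C ∧ y = Lbl.D) ∨ (x = Lbl.D ∧ y = Lbl.C) := by
  cases x <;> cases y <;> simp_all [cls]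

variable {t : ℕ} {M₀ : Finset (Sym2 (Fin n))}

/-- The swap is again a partition. [cite: Rothvoss2017, proof of Lemma 14 (PDF p. 12)] -/
theorem swapLab_mem_partitions (h : lab ∈ Pfib n m k t U₀ M₀) (hi : Disjoint (lblk lab (Lbl.A i)) U₀)
    (hk : 3 ≤ k) : swapLab U₀ i lab ∈ partitions n m k := by
  classical
  have hP := mem_partitions_iff.1 (Pfib_parts h).1
  have h3 : (U₀ ∩ lblk lab Lbl.C).card = 3 := by rw [(Pfib_parts h).2.2.2.1, card_cov (Pfib_parts h).2.1]
  rw [mem_partitions_iff]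
  intro ℓ
  by_cases hC : ℓ = Lbl.C
  · subst hC
    rw [lblk_swapLab_C hi, card_union_of_disjoint, h3, hP (Lbl.A i)]
    · simp only [Lbl.size]; omega
    · exact disjoint_left.2 fun v hv hv' => disjoint_left.1 hi hv' (mem_inter.1 hv).1
  by_cases hA : ℓ = Lbl.A i
  · subst hA
    rw [lblk_swapLab_A hi]
    have h1 := card_sdiff_add_card_inter (lblk lab Lbl.C) U₀
    rw [inter_comm, h3, hP Lbl.C] at h1
    simp only [Lbl.size] at h1 ⊢
    omega
  · rw [lblk_swapLab_of_ne hA hC]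
    exact hP ℓ

/-- On the edges of `M*`, being a `C`–`D` edge is unchanged by the swap.
[cite: Rothvoss2017, proof of Lemma 14 (PDF p. 12)] -/
theorem isCD_swapLab_iff (h : lab ∈ Pfib n m k t U₀ M₀)
    {e : Sym2 (Fin n)} (he : e ∈ M₀) : IsCD (swapLab U₀ i lab) e ↔ IsCD lab e := by
  have hD : ∀ v, swapLab U₀ i lab v = Lbl.D ↔ lab v = Lbl.D := fun v =>
    swapLab_eq_iff_of_ne (by simp) (by simp)
  -- one direction of `C` at an end of a respecting edge whose other end is `D`
  have key : ∀ u v, s(u, v) ∈ M₀ → swapLab U₀ i lab u = Lbl.C → lab v = Lbl.D → lab u = Lbl.C := by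
    intro u v huv hu hv
    by_cases hu₀ : u ∈ U₀
    · rwa [swapLab_of_mem hu₀] at hu
    · rw [swapLab_of_not_mem hu₀, Equiv.swap_apply_eq_iff, Equiv.swap_apply_right] at hu
      have hre := (Pfib_parts h).2.2.2.2.2 _ huv
      rw [eResp_mk, hu, hv] at hre
      simp [cls] at hre
  have key' : ∀ u v, s(u, v) ∈ M₀ → lab u = Lbl.C → lab v = Lbl.D → swapLab U₀ i lab u = Lbl.C := by
    intro u v huv hu hv
    have hcd : IsCD lab s(u, v) := isCD_mk.2 (Or.inl ⟨hu, hv⟩)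
    rw [swapLab_of_mem ((Pfib_mem_of_isCD h) huv hcd (Sym2.mem_mk_left u v) hu), hu]
  induction e using Sym2.ind with
  | h u v =>
    rw [isCD_mk, isCD_mk, hD u, hD v]
    constructor
    · rintro (⟨hu, hv⟩ | ⟨hu, hv⟩)
      · exact Or.inl ⟨key u v he hu hv, hv⟩
      · exact Or.inr ⟨hu, key v u (by rw [Sym2.eq_swap]; exact he) hv hu⟩
    · rintro (⟨hu, hv⟩ | ⟨hu, hv⟩)
      · exact Or.inl ⟨key' u v he hu hv, hv⟩
      · exact Or.inr ⟨hu, key' v u (by rw [Sym2.eq_swap]; exact he) hv hu⟩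

/-- Hence `M* ∩ (C × D)` is unchanged: the `3`-matching `H` stays. [folklore] -/
theorem filter_isCD_swapLab (h : lab ∈ Pfib n m k t U₀ M₀) :
    M₀.filter (IsCD (swapLab U₀ i lab)) = M₀.filter (IsCD lab) :=
  filter_congr fun _ he => isCD_swapLab_iff h he

/-- `V(H) ∩ C` is unchanged. [folklore] -/
theorem cov_swapLab (h : lab ∈ Pfib n m k t U₀ M₀) :
    cov (swapLab U₀ i lab) (M₀.filter (IsCD lab)) = cov lab (M₀.filter (IsCD lab)) := by
  ext c
  simp only [mem_cov_iff]
  constructor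
  · rintro ⟨hc, e, he, hce⟩
    refine ⟨?_, e, he, hce⟩
    obtain ⟨heM, hcd⟩ := mem_filter.1 he
    by_cases hc₀ : c ∈ U₀
    · rwa [swapLab_of_mem hc₀] at hc
    · -- then `lab c = A i`, impossible on a `C`–`D` edge
      rw [swapLab_of_not_mem hc₀, Equiv.swap_apply_eq_iff, Equiv.swap_apply_right] at hc
      obtain ⟨c', d, rfl, hc', hd⟩ := hcd
      rcases Sym2.mem_iff.1 hce with rfl | rfl
      · rw [hc] at hc'; cases hc'
      · rw [hc] at hd; cases hd
  · rintro ⟨hc, e, he, hce⟩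
    obtain ⟨heM, hcd⟩ := mem_filter.1 he
    refine ⟨?_, e, he, hce⟩
    rw [swapLab_of_mem ((Pfib_mem_of_isCD h) heM hcd hce hc), hc]

/-- `H` is still a `3`-matching between `C` and `D`. [folklore] -/
theorem cdMatchings_swapLab (h : lab ∈ Pfib n m k t U₀ M₀) (i : Fin m) :
    M₀.filter (IsCD lab) ∈ cdMatchings (swapLab U₀ i lab) 3 := by
  obtain ⟨hcd, hcard, hmatch⟩ := mem_cdMatchings_iff.1 (Pfib_parts h).2.1
  refine mem_cdMatchings_iff.2 ⟨fun e he => ?_, hcard, hmatch⟩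
  exact (isCD_swapLab_iff h (mem_filter.1 he).1).2 (mem_filter.1 he).2

/-- `U*` is still a `t`-cut of whole `A`-blocks. [cite: Rothvoss2017, proof of Lemma 14 (PDF p. 12)] -/
theorem Uall_swapLab (h : lab ∈ Pfib n m k t U₀ M₀) (hi : Disjoint (lblk lab (Lbl.A i)) U₀) :
    U₀ ∈ Uall (swapLab U₀ i lab) t := by
  obtain ⟨hcard, hAC, hwhole⟩ := mem_Uall_iff.1 (Pfib_parts h).2.2.1
  refine mem_Uall_iff.2 ⟨hcard, fun v hv => by rw [swapLab_of_mem hv]; exact hAC v hv, ?_⟩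
  intro u hu v hvu hAu
  rw [swapLab_of_mem hu] at hvu hAu
  by_contra hv
  rw [swapLab_of_not_mem hv, Equiv.swap_apply_eq_iff] at hvu
  -- `lab u = A j` with `j ≠ i`
  cases hlu : lab u with
  | C => rw [hlu] at hAu; exact absurd hAu (by simp [Lbl.isA])
  | D => rw [hlu] at hAu; exact absurd hAu (by simp [Lbl.isA])
  | B j => rw [hlu] at hAu; exact absurd hAu (by simp [Lbl.isA])
  | A j =>
    have hji : j ≠ i := by
      rintro rfl
      exact disjoint_left.1 hi (mem_lblk.2 hlu) hu
    rw [hlu, Equiv.swap_apply_of_ne_of_ne (by simpa using hji) (by simp)] at hvu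
    exact hv (hwhole u hu v (by rw [hvu, hlu]) (by rw [hlu]; rfl))

/-- `U*` still extends `H`. [folklore] -/
theorem Uext_swapLab (h : lab ∈ Pfib n m k t U₀ M₀) (hi : Disjoint (lblk lab (Lbl.A i)) U₀) :
    U₀ ∈ Uext (swapLab U₀ i lab) t (M₀.filter (IsCD lab)) := by
  refine mem_Uext_iff.2 ⟨Uall_swapLab h hi, ?_⟩
  rw [cov_swapLab h, lblk_swapLab_C hi, inter_union_distrib_left, ← inter_assoc, inter_self,
    (Pfib_parts h).2.2.2.1, disjoint_iff_inter_eq_empty.1 hi.symm, union_empty]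

/-- `M*` still respects the partition. [cite: Rothvoss2017, proof of Lemma 14 (PDF p. 12)] -/
theorem Mall_swapLab (h : lab ∈ Pfib n m k t U₀ M₀) (i : Fin m) :
    M₀ ∈ Mall (swapLab U₀ i lab) := by
  have hPM := (Pfib_parts h).2.2.2.2.1
  have hresp := (Pfib_parts h).2.2.2.2.2
  refine mem_Mall_iff.2 ⟨hPM, ?_⟩
  -- the mixed case: `u ∈ U*`, `v ∉ U*`
  have mixed : ∀ u v, s(u, v) ∈ M₀ → u ∈ U₀ → v ∉ U₀ →
      cls (swapLab U₀ i lab u) = cls (swapLab U₀ i lab v) := by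
    intro u v huv hu hv
    have hre : cls (lab u) = cls (lab v) := eResp_mk.1 (hresp _ huv)
    rw [swapLab_of_mem hu, swapLab_of_not_mem hv]
    have hAC := (Pfib_isAC h) hu
    cases hlu : lab u with
    | D => rw [hlu] at hAC; exact absurd hAC (by simp [Lbl.isAC])
    | B j => rw [hlu] at hAC; exact absurd hAC (by simp [Lbl.isAC])
    | A j =>
      rw [hlu, cls_A, eq_comm, cls_eq_A_iff] at hre
      exact absurd ((Pfib_whole h) hu hlu hre) hv
    | C =>
      rw [hlu, cls_C, eq_comm, cls_eq_C_iff] at hre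
      rcases hre with hvC | hvD
      · -- both ends `C`: the edge at `u ∈ V(H) ∩ C` would be a `C`–`D` edge
        have hcd := (Pfib_isCD_of_mem h) hu hlu huv (Sym2.mem_mk_left u v)
        rcases isCD_mk.1 hcd with ⟨-, hvD⟩ | ⟨huD, -⟩
        · rw [hvC] at hvD; cases hvD
        · rw [hlu] at huD; cases huD
      · rw [hvD, Equiv.swap_apply_of_ne_of_ne (by simp) (by simp), cls_C, cls_D]
  intro e he
  induction e using Sym2.ind with
  | h u v =>
    rw [eResp_mk]
    have hre : cls (lab u) = cls (lab v) := eResp_mk.1 (hresp _ he)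
    by_cases hu : u ∈ U₀ <;> by_cases hv : v ∈ U₀
    · rw [swapLab_of_mem hu, swapLab_of_mem hv, hre]
    · exact mixed u v he hu hv
    · exact (mixed v u (by rw [Sym2.eq_swap]; exact he) hv hu).symm
    · rw [swapLab_of_not_mem hu, swapLab_of_not_mem hv]
      by_cases heq : lab u = lab v
      · rw [heq]
      · rcases cls_eq_cls_of_ne hre heq with ⟨hC, hD⟩ | ⟨hD, hC⟩
        · exact absurd ((Pfib_mem_of_isCD h) he (isCD_mk.2 (Or.inl ⟨hC, hD⟩)) (Sym2.mem_mk_left u v) hC) hu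
        · exact absurd ((Pfib_mem_of_isCD h) he (isCD_mk.2 (Or.inr ⟨hD, hC⟩)) (Sym2.mem_mk_right u v) hC) hv

/-- `M*` still extends `H`. [folklore] -/
theorem Mext_swapLab (h : lab ∈ Pfib n m k t U₀ M₀) (i : Fin m) :
    M₀ ∈ Mext (swapLab U₀ i lab) (M₀.filter (IsCD lab)) :=
  mem_Mext_iff.2 ⟨Mall_swapLab h i, filter_isCD_swapLab h⟩

/-- **The swap stays in the fibre.** [cite: Rothvoss2017, proof of Lemma 14 (PDF p. 12: "T_i ∈ 𝒫(U*, M*)")] -/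
theorem swapLab_mem_Pfib (h : lab ∈ Pfib n m k t U₀ M₀) (hi : Disjoint (lblk lab (Lbl.A i)) U₀)
    (hk : 3 ≤ k) : swapLab U₀ i lab ∈ Pfib n m k t U₀ M₀ := by
  rw [mem_Pfib_iff, filter_isCD_swapLab h]
  exact ⟨swapLab_mem_partitions h hi hk, cdMatchings_swapLab h i, Uext_swapLab h hi, Mext_swapLab h i⟩

/-- After the swap, `A_i = C ∖ U*` is again outside `U*`. [folklore] -/
theorem disjoint_lblk_swapLab (hi : Disjoint (lblk lab (Lbl.A i)) U₀) :
    Disjoint (lblk (swapLab U₀ i lab) (Lbl.A i)) U₀ := by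
  rw [lblk_swapLab_A hi]; exact sdiff_disjoint

/-! ### The family `{swap_ℓ(T) : ℓ ∈ Lout(T)}` -/

/-- The family indices of `T`: `none` (for `T` itself) and the `A`-blocks outside `U*`.
[cite: Rothvoss2017, proof of Lemma 14 (PDF p. 11: "J := {i ∈ [m+1] : Ã_i ∩ U* = ∅}")] -/
def Lout (U₀ : Finset (Fin n)) (lab : Fin n → Lbl m) : Finset (Option (Fin m)) :=
  Finset.insertNone (univ.filter fun i => Disjoint (lblk lab (Lbl.A i)) U₀)

/-- `none ∈ Lout`. [folklore] -/
@[simp] theorem none_mem_Lout : (none : Option (Fin m)) ∈ Lout U₀ lab := by simp [Lout]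

/-- `some i ∈ Lout ↔ A_i ∩ U* = ∅`. [folklore] -/
@[simp] theorem some_mem_Lout : some i ∈ Lout U₀ lab ↔ Disjoint (lblk lab (Lbl.A i)) U₀ := by
  simp [Lout]

/-- **Every member of the family is in the fibre.** [cite: Rothvoss2017, proof of Lemma 14 (PDF p. 12)] -/
theorem swapO_mem_Pfib (h : lab ∈ Pfib n m k t U₀ M₀) (hk : 3 ≤ k) :
    ∀ {ℓ : Option (Fin m)}, ℓ ∈ Lout U₀ lab → swapO U₀ ℓ lab ∈ Pfib n m k t U₀ M₀
  | none, _ => h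
  | some _, hℓ => swapLab_mem_Pfib h (some_mem_Lout.1 hℓ) hk

/-- **The family relation is symmetric**: `ℓ ∈ Lout(swap_ℓ T)`. [folklore] -/
theorem mem_Lout_swapO : ∀ {ℓ : Option (Fin m)}, ℓ ∈ Lout U₀ lab → ℓ ∈ Lout U₀ (swapO U₀ ℓ lab)
  | none, _ => none_mem_Lout
  | some _, hℓ => some_mem_Lout.2 (disjoint_lblk_swapLab (some_mem_Lout.1 hℓ))

/-- An `A`-block meets `U*` iff it is one of the blocks of `U*`. [folklore] -/
theorem disjoint_lblk_iff_not_mem_idxU : Disjoint (lblk lab (Lbl.A i)) U₀ ↔ i ∉ idxU lab U₀ := by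
  simp only [idxU, mem_filter, mem_univ, true_and, not_exists, not_and, disjoint_right, mem_lblk]

/-- **The family has `(m+1)/2` members** (for `m` odd, `t = 3 + ((m+1)/2)(k-3)`, `k > 3`).
[cite: Rothvoss2017, proof of Lemma 14 (PDF p. 11: "|J| = (m+1)/2")] -/
theorem card_Lout (h : lab ∈ Pfib n m k t U₀ M₀) (hk : 3 < k) (hm : m % 2 = 1)
    (ht : t = (m + 1) / 2 * (k - 3) + 3) : (Lout U₀ lab).card = (m + 1) / 2 := by
  classical
  have hU : U₀ ∈ Uext lab t (M₀.filter (IsCD lab)) := (mem_Pfib_iff.1 h).2.2.1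
  have hidx := card_idxU (Pfib_parts h).1 (Pfib_parts h).2.1 hk (j := (m + 1) / 2) (by rw [ht, add_comm]) hU
  have hfilter : (univ.filter fun i => Disjoint (lblk lab (Lbl.A i)) U₀) = (idxU lab U₀)ᶜ := by
    ext i; simp only [mem_filter, mem_univ, true_and, mem_compl, disjoint_lblk_iff_not_mem_idxU]
  rw [Lout, card_insertNone, hfilter, card_compl, hidx, Fintype.card_fin]
  omega

end Swap

/-! ### Cuts as images of index sets (for any partition) -/

section CutImages

variable {lab : Fin n → Lbl m} {r t : ℕ} {H : Finset (Sym2 (Fin n))}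

/-- `U^ex(T, H)` is the image of the `j`-sets of `A`-blocks under `mkU` (`t = r + j(k-3)`).
[cite: Rothvoss2017, §3.1 (PDF p. 8)] -/
theorem Uext_eq_image_mkU (hlab : lab ∈ partitions n m k) (hH : H ∈ cdMatchings lab r) (hk : 3 < k)
    {j : ℕ} (ht : r + j * (k - 3) = t) :
    Uext lab t H = ((univ : Finset (Fin m)).powersetCard j).image (mkU lab H) := by
  classical
  ext U
  rw [mem_image]
  constructor
  · intro hU
    exact ⟨idxU lab U, mem_powersetCard.2 ⟨subset_univ _, card_idxU hlab hH hk ht hU⟩, mkU_idxU hU⟩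
  · rintro ⟨I, hI, rfl⟩
    exact mkU_mem_Uext hlab hH I (by rw [(mem_powersetCard.1 hI).2]; exact ht)

/-- `mkU` is injective (`k > 3`). [folklore] -/
theorem mkU_injective (hlab : lab ∈ partitions n m k) (hk : 3 < k) :
    Function.Injective (mkU lab H) := fun I I' h => by
  rw [← idxU_mkU (H := H) hlab hk I, h, idxU_mkU hlab hk I']

/-- `|X ∩ (image of an injective map)|` counts the good parameters. [folklore] -/
theorem card_inter_image_eq {α β : Type*} [DecidableEq β] (X : Finset β) (S : Finset α) {f : α → β}
    (hf : Function.Injective f) : (X ∩ S.image f).card = (S.filter fun a => f a ∈ X).card := by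
  classical
  rw [← card_image_of_injective (S.filter fun a => f a ∈ X) hf]
  congr 1
  ext b
  simp only [mem_inter, mem_image, mem_filter]
  constructor
  · rintro ⟨hb, a, ha, rfl⟩; exact ⟨a, ⟨ha, hb⟩, rfl⟩
  · rintro ⟨a, ⟨ha, hb⟩, rfl⟩; exact ⟨hb, a, ha, rfl⟩

/-- `|X ∩ U^ex(T, H)|` as a count of index sets. [folklore] -/
theorem card_inter_Uext_eq (hlab : lab ∈ partitions n m k) (hH : H ∈ cdMatchings lab r) (hk : 3 < k)
    {j : ℕ} (ht : r + j * (k - 3) = t) (X : Finset (Finset (Fin n))) :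
    (X ∩ Uext lab t H).card =
      (((univ : Finset (Fin m)).powersetCard j).filter fun I => mkU lab H I ∈ X).card := by
  rw [Uext_eq_image_mkU hlab hH hk ht, card_inter_image_eq X _ (mkU_injective hlab hk)]

/-- For a `k`-matching `F`, `mkU T F I = C ∪ ⋃_{i ∈ I} A_i`. [folklore] -/
theorem mkU_k_eq (hlab : lab ∈ partitions n m k) {F : Finset (Sym2 (Fin n))} (hF : F ∈ cdMatchings lab k)
    (I : Finset (Fin m)) : mkU lab F I = lblk lab Lbl.C ∪ univ.filter fun v => ∃ i ∈ I, lab v = Lbl.A i := by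
  have hcov : cov lab F = lblk lab Lbl.C := by
    refine eq_of_subset_of_card_le (fun c hc => mem_lblk.2 (mem_cov_iff.1 hc).1) ?_
    rw [card_cov hF, (mem_partitions_iff.1 hlab) Lbl.C]
    exact le_of_eq rfl
  rw [mkU, hcov]

end CutImages

/-! ### The cube `{0,1}^{m+1}` of a partition of the fibre -/

section Cube

variable {t : ℕ} {U₀ : Finset (Fin n)} {M₀ : Finset (Sym2 (Fin n))} {lab : Fin n → Lbl m}

variable (U₀ lab) in
/-- The `m + 1` blocks of size `k - 3` of the family of `T`: `famBlk none = C ∖ U*` and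
`famBlk (some i) = A_i` (Rothvoß's `Ã_1, …, Ã_{m+1}`). [cite: Rothvoss2017, proof of Lemma 14 (PDF p. 11)] -/
def famBlk : Option (Fin m) → Finset (Fin n)
  | none => lblk lab Lbl.C \ U₀
  | some i => lblk lab (Lbl.A i)

/-- The re-indexing of the `A`-blocks of `swap_{ℓ₀}(T)` by blocks of `T`. [folklore] -/
def ρidx (ℓ₀ : Option (Fin m)) (j : Fin m) : Option (Fin m) := if ℓ₀ = some j then none else some j

/-- `ρidx ℓ₀` is injective. [folklore] -/
theorem ρidx_injective (ℓ₀ : Option (Fin m)) : Function.Injective (ρidx ℓ₀) := by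
  intro j j' h
  unfold ρidx at h
  by_cases hj : ℓ₀ = some j <;> by_cases hj' : ℓ₀ = some j' <;> simp_all

/-- `ρidx ℓ₀` misses `ℓ₀`. [folklore] -/
theorem ρidx_ne (ℓ₀ : Option (Fin m)) (j : Fin m) : ρidx ℓ₀ j ≠ ℓ₀ := by
  unfold ρidx
  by_cases hj : ℓ₀ = some j
  · rw [if_pos hj, hj]; simp
  · rw [if_neg hj]; exact fun h => hj h.symm

/-- The `A`-blocks of a member of the family are blocks of `T`. [folklore] -/
theorem lblk_swapO_A {ℓ₀ : Option (Fin m)} (hℓ₀ : ℓ₀ ∈ Lout U₀ lab) (j : Fin m) :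
    lblk (swapO U₀ ℓ₀ lab) (Lbl.A j) = famBlk U₀ lab (ρidx ℓ₀ j) := by
  cases ℓ₀ with
  | none => simp [ρidx, famBlk]
  | some i =>
    have hi := some_mem_Lout.1 hℓ₀
    by_cases hj : i = j
    · subst hj
      simp only [swapO_some, ρidx, if_true, famBlk]
      exact lblk_swapLab_A hi
    · have hne : (some i : Option (Fin m)) ≠ some j := fun h => hj (Option.some_injective _ h)
      simp only [swapO_some, ρidx, if_neg hne, famBlk]
      exact lblk_swapLab_of_ne (fun h => hj (Lbl.A.injEq _ _ ▸ h).symm) (by simp)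

/-- The `C`-block of a member of the family: `(U* ∩ C) ∪ famBlk ℓ₀`. [folklore] -/
theorem lblk_swapO_C {ℓ₀ : Option (Fin m)} (hℓ₀ : ℓ₀ ∈ Lout U₀ lab) :
    lblk (swapO U₀ ℓ₀ lab) Lbl.C = (U₀ ∩ lblk lab Lbl.C) ∪ famBlk U₀ lab ℓ₀ := by
  cases ℓ₀ with
  | none =>
    simp only [swapO_none, famBlk]
    ext v; simp only [mem_union, mem_inter, mem_sdiff]; tauto
  | some i => exact lblk_swapLab_C (some_mem_Lout.1 hℓ₀)

/-- The points of the cube: `H_C ∪ ⋃_{ℓ ∈ J} famBlk ℓ`. [cite: Rothvoss2017, proof of Lemma 14 (PDF p. 12: "f(y) := H_C ∪ ⋃_{y_i = 1} Ã_i")] -/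
def cubeU (HC : Finset (Fin n)) (b : Option (Fin m) → Finset (Fin n)) (J : Finset (Option (Fin m))) :
    Finset (Fin n) :=
  HC ∪ J.biUnion b

/-- **The `H`-extending cuts of `swap_{ℓ₀}(T)` are the cube points avoiding `ℓ₀`**: `mkU` of an
index set is `cubeU` of its re-indexed image. [cite: Rothvoss2017, proof of Lemma 14 (PDF p. 12)] -/
theorem mkU_swapO_eq (h : lab ∈ Pfib n m k t U₀ M₀) {ℓ₀ : Option (Fin m)} (hℓ₀ : ℓ₀ ∈ Lout U₀ lab)
    (I : Finset (Fin m)) :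
    mkU (swapO U₀ ℓ₀ lab) (M₀.filter (IsCD lab)) I =
      cubeU (cov lab (M₀.filter (IsCD lab))) (famBlk U₀ lab) (I.image (ρidx ℓ₀)) := by
  classical
  have hcov : cov (swapO U₀ ℓ₀ lab) (M₀.filter (IsCD lab)) = cov lab (M₀.filter (IsCD lab)) := by
    cases ℓ₀ with
    | none => rfl
    | some i => exact cov_swapLab h
  rw [mkU, hcov, cubeU, image_biUnion]
  congr 1
  ext v
  simp only [mem_filter, mem_univ, true_and, mem_biUnion]
  constructor
  · rintro ⟨j, hj, hv⟩
    exact ⟨j, hj, by rw [← lblk_swapO_A hℓ₀ j]; exact mem_lblk.2 hv⟩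
  · rintro ⟨j, hj, hv⟩
    exact ⟨j, hj, by rw [← lblk_swapO_A hℓ₀ j] at hv; exact mem_lblk.1 hv⟩

/-- **The `C`-containing cuts of `swap_{ℓ₀}(T)` are the cube points through `ℓ₀`.**
[cite: Rothvoss2017, proof of Lemma 14 (PDF p. 12: "U ∩ C ∈ {H_C, C}, depending on whether y_i = 0 or y_i = 1")] -/
theorem mkU_swapO_k_eq (h : lab ∈ Pfib n m k t U₀ M₀) {ℓ₀ : Option (Fin m)} (hℓ₀ : ℓ₀ ∈ Lout U₀ lab)
    (hk : 3 ≤ k) {F : Finset (Sym2 (Fin n))} (hF : F ∈ cdMatchings (swapO U₀ ℓ₀ lab) k)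
    (I : Finset (Fin m)) :
    mkU (swapO U₀ ℓ₀ lab) F I =
      cubeU (cov lab (M₀.filter (IsCD lab))) (famBlk U₀ lab) (insert ℓ₀ (I.image (ρidx ℓ₀))) := by
  classical
  have hlab' : swapO U₀ ℓ₀ lab ∈ partitions n m k := (Pfib_parts (swapO_mem_Pfib h hk hℓ₀)).1
  rw [mkU_k_eq hlab' hF, lblk_swapO_C hℓ₀, (Pfib_parts h).2.2.2.1, cubeU, biUnion_insert,
    image_biUnion, union_assoc]
  congr 1
  ext v
  simp only [mem_union, mem_filter, mem_univ, true_and, mem_biUnion]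
  constructor
  · rintro (hv | ⟨j, hj, hv⟩)
    · exact Or.inl hv
    · exact Or.inr ⟨j, hj, by rw [← lblk_swapO_A hℓ₀ j]; exact mem_lblk.2 hv⟩
  · rintro (hv | ⟨j, hj, hv⟩)
    · exact Or.inl hv
    · exact Or.inr ⟨j, hj, by rw [← lblk_swapO_A hℓ₀ j] at hv; exact mem_lblk.1 hv⟩

/-! #### Re-indexing the index sets -/

/-- The images of the `j`-subsets of `[m]` under `ρidx ℓ₀` are the `j`-subsets avoiding `ℓ₀`.
[folklore] -/
theorem image_powersetCard_ρidx (ℓ₀ : Option (Fin m)) (j : ℕ) :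
    ((univ : Finset (Fin m)).powersetCard j).image (fun I => I.image (ρidx ℓ₀)) =
      ((univ : Finset (Option (Fin m))).powersetCard j).filter fun J => ℓ₀ ∉ J := by
  classical
  have hinj := ρidx_injective ℓ₀
  refine eq_of_subset_of_card_le (fun J hJ => ?_) ?_
  · obtain ⟨I, hI, rfl⟩ := mem_image.1 hJ
    rw [mem_filter, mem_powersetCard]
    refine ⟨⟨subset_univ _, ?_⟩, ?_⟩
    · rw [card_image_of_injective _ hinj, (mem_powersetCard.1 hI).2]
    · rw [mem_image]
      rintro ⟨i, -, hi⟩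
      exact ρidx_ne ℓ₀ i hi
  · have hR : (((univ : Finset (Option (Fin m))).powersetCard j).filter fun J => ℓ₀ ∉ J) =
        (univ.erase ℓ₀).powersetCard j := by
      ext J
      simp only [mem_filter, mem_powersetCard, subset_univ, true_and]
      constructor
      · rintro ⟨hJ, hℓ⟩
        exact ⟨fun x hx => mem_erase.2 ⟨fun hxe => hℓ (hxe ▸ hx), mem_univ _⟩, hJ⟩
      · rintro ⟨hsub, hJ⟩
        exact ⟨hJ, fun hℓ => (mem_erase.1 (hsub hℓ)).1 rfl⟩
    rw [hR, card_powersetCard, card_erase_of_mem (mem_univ _), card_univ, Fintype.card_option,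
      Fintype.card_fin, Nat.add_sub_cancel,
      card_image_of_injective _ (image_injective hinj), card_powersetCard, card_univ, Fintype.card_fin]

/-- Inserting `ℓ₀` into the images: the `(j+1)`-subsets through `ℓ₀`. [folklore] -/
theorem image_powersetCard_insert_ρidx (ℓ₀ : Option (Fin m)) (j : ℕ) :
    ((univ : Finset (Fin m)).powersetCard j).image (fun I => insert ℓ₀ (I.image (ρidx ℓ₀))) =
      ((univ : Finset (Option (Fin m))).powersetCard (j + 1)).filter fun J => ℓ₀ ∈ J := by
  classical
  have hinj := ρidx_injective ℓ₀
  have hnot : ∀ I : Finset (Fin m), ℓ₀ ∉ I.image (ρidx ℓ₀) := fun I hI => by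
    obtain ⟨i, -, hi⟩ := mem_image.1 hI
    exact ρidx_ne ℓ₀ i hi
  have hinj2 : Function.Injective fun I : Finset (Fin m) => insert ℓ₀ (I.image (ρidx ℓ₀)) := by
    intro I I' hII'
    have := congrArg (fun J => Finset.erase J ℓ₀) hII'
    simp only [erase_insert (hnot I), erase_insert (hnot I')] at this
    exact image_injective hinj this
  have hsub : ((univ : Finset (Fin m)).powersetCard j).image
      (fun I => insert ℓ₀ (I.image (ρidx ℓ₀))) ⊆
      ((univ : Finset (Option (Fin m))).powersetCard (j + 1)).filter fun J => ℓ₀ ∈ J := by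
    intro J hJ
    obtain ⟨I, hI, rfl⟩ := mem_image.1 hJ
    rw [mem_filter, mem_powersetCard]
    refine ⟨⟨subset_univ _, ?_⟩, mem_insert_self _ _⟩
    rw [card_insert_of_notMem (hnot I), card_image_of_injective _ hinj, (mem_powersetCard.1 hI).2]
  refine eq_of_subset_of_card_le hsub ?_
  -- the right-hand side injects into the `j`-subsets of `univ.erase ℓ₀` by erasing `ℓ₀`
  have hle : (((univ : Finset (Option (Fin m))).powersetCard (j + 1)).filter fun J => ℓ₀ ∈ J).card ≤
      ((univ.erase ℓ₀).powersetCard j).card := by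
    refine card_le_card_of_injOn (fun J => J.erase ℓ₀) (fun J hJ => ?_) (fun J hJ J' hJ' hJJ' => ?_)
    · rw [mem_coe, mem_filter, mem_powersetCard] at hJ
      rw [mem_coe, mem_powersetCard]
      refine ⟨erase_subset_erase _ (subset_univ _), ?_⟩
      rw [card_erase_of_mem hJ.2, hJ.1.2, Nat.add_sub_cancel]
    · rw [mem_coe, mem_filter] at hJ hJ'
      rw [← insert_erase hJ.2, ← insert_erase hJ'.2]
      exact congrArg _ hJJ'
  refine hle.trans (le_of_eq ?_)
  rw [card_powersetCard, card_erase_of_mem (mem_univ _), card_univ, Fintype.card_option,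
    Fintype.card_fin, Nat.add_sub_cancel,
    card_image_of_injective _ hinj2, card_powersetCard, card_univ, Fintype.card_fin]

/-! #### The three counts of a family member, read off the cube -/

/-- The index sets of the cube: the `(m+1)/2`-subsets of the `m + 1` blocks.
[cite: Rothvoss2017, proof of Lemma 14 (PDF p. 12: "|Y'| := {y : ‖y‖₁ = (m+1)/2}")] -/
def cubeIdx (m : ℕ) : Finset (Finset (Option (Fin m))) :=
  (univ : Finset (Option (Fin m))).powersetCard ((m + 1) / 2)

/-- **`|X ∩ U^ex(swap_{ℓ₀} T, H)|` = the cube points of `X` avoiding `ℓ₀`.**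
[cite: Rothvoss2017, proof of Lemma 14 (PDF p. 12: "Pr[f(y) ∈ 𝓤 | y_i = 0] = p^ex_{U,T_i}(H)")] -/
theorem card_inter_Uext_swapO (h : lab ∈ Pfib n m k t U₀ M₀) (hk : 3 < k)
    (ht : t = (m + 1) / 2 * (k - 3) + 3) {ℓ₀ : Option (Fin m)} (hℓ₀ : ℓ₀ ∈ Lout U₀ lab)
    (X : Finset (Finset (Fin n))) :
    (X ∩ Uext (swapO U₀ ℓ₀ lab) t (M₀.filter (IsCD lab))).card =
      (((cubeIdx m).filter fun J => cubeU (cov lab (M₀.filter (IsCD lab))) (famBlk U₀ lab) J ∈ X).filter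
        fun J => ℓ₀ ∉ J).card := by
  classical
  have h' := swapO_mem_Pfib h hk.le hℓ₀
  have hlab' := (Pfib_parts h').1
  have hH' : M₀.filter (IsCD lab) ∈ cdMatchings (swapO U₀ ℓ₀ lab) 3 := by
    have := (Pfib_parts h').2.1
    cases ℓ₀ with
    | none => exact this
    | some i => rwa [swapO_some, filter_isCD_swapLab h] at this
  rw [card_inter_Uext_eq hlab' hH' hk (j := (m + 1) / 2) (by rw [ht, add_comm]) X]
  rw [filter_filter]
  have hkey : (((univ : Finset (Fin m)).powersetCard ((m + 1) / 2)).filter fun I =>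
      mkU (swapO U₀ ℓ₀ lab) (M₀.filter (IsCD lab)) I ∈ X) =
      ((univ : Finset (Fin m)).powersetCard ((m + 1) / 2)).filter fun I =>
        cubeU (cov lab (M₀.filter (IsCD lab))) (famBlk U₀ lab) (I.image (ρidx ℓ₀)) ∈ X :=
    filter_congr fun I _ => by rw [mkU_swapO_eq h hℓ₀ I]
  have e1 : (((univ : Finset (Fin m)).powersetCard ((m + 1) / 2)).filter fun I =>
      cubeU (cov lab (M₀.filter (IsCD lab))) (famBlk U₀ lab) (I.image (ρidx ℓ₀)) ∈ X).card =
      ((((univ : Finset (Fin m)).powersetCard ((m + 1) / 2)).image fun I => I.image (ρidx ℓ₀)).filter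
        fun J => cubeU (cov lab (M₀.filter (IsCD lab))) (famBlk U₀ lab) J ∈ X).card := by
    rw [filter_image]
    exact (card_image_of_injective _ (image_injective (ρidx_injective ℓ₀))).symm
  rw [hkey, e1, image_powersetCard_ρidx, filter_filter, cubeIdx]
  congr 1
  exact filter_congr fun J _ => and_comm

/-- **`|X ∩ U^ex(swap_{ℓ₀} T, C)|` = the cube points of `X` through `ℓ₀`.**
[cite: Rothvoss2017, proof of Lemma 14 (PDF p. 12: "Pr[f(y) ∈ 𝓤 | y_i = 1] = p^ex_{U,T_i}(C)")] -/
theorem card_inter_UextC_swapO (h : lab ∈ Pfib n m k t U₀ M₀) (hk : 3 < k) (hm : m % 2 = 1)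
    (ht : t = (m + 1) / 2 * (k - 3) + 3) {ℓ₀ : Option (Fin m)} (hℓ₀ : ℓ₀ ∈ Lout U₀ lab)
    (X : Finset (Finset (Fin n))) :
    (X ∩ UextC (swapO U₀ ℓ₀ lab) t).card =
      (((cubeIdx m).filter fun J => cubeU (cov lab (M₀.filter (IsCD lab))) (famBlk U₀ lab) J ∈ X).filter
        fun J => ℓ₀ ∈ J).card := by
  classical
  have h' := swapO_mem_Pfib h hk.le hℓ₀
  have hlab' := (Pfib_parts h').1
  obtain ⟨F, hF⟩ := cdMatchings_nonempty hlab' le_rfl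
  rw [← Uext_k_eq_UextC hlab' hF,
    card_inter_Uext_eq hlab' hF hk (j := (m - 1) / 2) ?_ X, filter_filter]
  swap
  · have h1 : (m + 1) / 2 = (m - 1) / 2 + 1 := by omega
    rw [ht, h1, add_mul, one_mul, add_assoc, Nat.sub_add_cancel hk.le, add_comm]
  have hkey : (((univ : Finset (Fin m)).powersetCard ((m - 1) / 2)).filter fun I =>
      mkU (swapO U₀ ℓ₀ lab) F I ∈ X) =
      ((univ : Finset (Fin m)).powersetCard ((m - 1) / 2)).filter fun I =>
        cubeU (cov lab (M₀.filter (IsCD lab))) (famBlk U₀ lab) (insert ℓ₀ (I.image (ρidx ℓ₀))) ∈ X :=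
    filter_congr fun I _ => by rw [mkU_swapO_k_eq h hℓ₀ hk.le hF I]
  have hinj : Function.Injective fun I : Finset (Fin m) => insert ℓ₀ (I.image (ρidx ℓ₀)) := by
    have hnot : ∀ I : Finset (Fin m), ℓ₀ ∉ I.image (ρidx ℓ₀) := fun I hI => by
      obtain ⟨i, -, hi⟩ := mem_image.1 hI
      exact ρidx_ne ℓ₀ i hi
    intro I I' hII'
    have := congrArg (fun J => Finset.erase J ℓ₀) hII'
    simp only [erase_insert (hnot I), erase_insert (hnot I')] at this
    exact image_injective (ρidx_injective ℓ₀) this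
  have e1 : (((univ : Finset (Fin m)).powersetCard ((m - 1) / 2)).filter fun I =>
      cubeU (cov lab (M₀.filter (IsCD lab))) (famBlk U₀ lab) (insert ℓ₀ (I.image (ρidx ℓ₀))) ∈ X).card =
      ((((univ : Finset (Fin m)).powersetCard ((m - 1) / 2)).image fun I =>
        insert ℓ₀ (I.image (ρidx ℓ₀))).filter
        fun J => cubeU (cov lab (M₀.filter (IsCD lab))) (famBlk U₀ lab) J ∈ X).card := by
    rw [filter_image]
    exact (card_image_of_injective _ hinj).symm
  have h2 : (m - 1) / 2 + 1 = (m + 1) / 2 := by omega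
  rw [hkey, e1, image_powersetCard_insert_ρidx, h2, filter_filter, cubeIdx]
  congr 1
  exact filter_congr fun J _ => and_comm

/-- `|U^ex(swap_{ℓ₀} T, H)| = binom(m, (m+1)/2)`. [folklore] -/
theorem card_Uext_swapO (h : lab ∈ Pfib n m k t U₀ M₀) (hk : 3 < k)
    (ht : t = (m + 1) / 2 * (k - 3) + 3) {ℓ₀ : Option (Fin m)} (hℓ₀ : ℓ₀ ∈ Lout U₀ lab) :
    (Uext (swapO U₀ ℓ₀ lab) t (M₀.filter (IsCD lab))).card = m.choose ((m + 1) / 2) := by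
  have h' := swapO_mem_Pfib h hk.le hℓ₀
  have hH' : M₀.filter (IsCD lab) ∈ cdMatchings (swapO U₀ ℓ₀ lab) 3 := by
    have := (Pfib_parts h').2.1
    cases ℓ₀ with
    | none => exact this
    | some i => rwa [swapO_some, filter_isCD_swapLab h] at this
  exact card_Uext (Pfib_parts h').1 hH' hk (by rw [ht, add_comm])

end Cube

/-! ### Lemma 10 on the cube `{0,1}^{m+1}` -/

section Entropy

/-- The indicator vector of an index set. [folklore] -/
def indVec (J : Finset (Option (Fin m))) : Option (Fin m) → Bool := fun ℓ => decide (ℓ ∈ J)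

/-- `indVec` is injective. [folklore] -/
theorem indVec_injective : Function.Injective (indVec (m := m)) := by
  intro J J' h
  ext ℓ
  have := congrFun h ℓ
  simpa [indVec] using this

/-- Counting indicator vectors with a prescribed coordinate. [folklore] -/
theorem card_filter_image_indVec (Yset : Finset (Finset (Option (Fin m)))) (ℓ : Option (Fin m)) (b : Bool) :
    ((Yset.image indVec).filter fun y => y ℓ = b).card = (Yset.filter fun J => decide (ℓ ∈ J) = b).card := by
  classical
  rw [filter_image, card_image_of_injective _ indVec_injective]
  rfl

/-- **Rothvoß's Lemma 10 on the cube `{0,1}^{m+1}`** (`q = 2`): for a nonempty family `𝒴` of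
index sets and a set `B` of coordinates each of which is `ε₁`-biased for `𝒴` (the proportion of
members avoiding, or containing, the coordinate is off `1/2` by more than the factor `1 + ε₁`),
`|B| · (ε₁/(2(1+ε₁)))²/2 ≤ (m+1) log 2 - log |𝒴|`. [cite: Rothvoss2017, Lemma 10 (PDF pp. 10–11)] -/
theorem card_biased_cube_le (Yset : Finset (Finset (Option (Fin m)))) (hne : Yset.Nonempty) {ε₁ : ℝ}
    (hε₁ : 0 < ε₁) (B : Finset (Option (Fin m)))
    (hB : ∀ ℓ ∈ B,
      ((1 + ε₁) * 2 * ((Yset.filter fun J => ℓ ∉ J).card : ℝ) < Yset.card ∨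
        (1 + ε₁) * (Yset.card : ℝ) < 2 * ((Yset.filter fun J => ℓ ∉ J).card : ℝ)) ∨
      ((1 + ε₁) * 2 * ((Yset.filter fun J => ℓ ∈ J).card : ℝ) < Yset.card ∨
        (1 + ε₁) * (Yset.card : ℝ) < 2 * ((Yset.filter fun J => ℓ ∈ J).card : ℝ))) :
    (B.card : ℝ) * ((ε₁ / ((1 + ε₁) * 2)) ^ 2 / 2) ≤ (m + 1) * Real.log 2 - Real.log Yset.card := by
  classical
  have hY : Yset.image indVec ⊆ Fintype.piFinset fun _ : Option (Fin m) => (univ : Finset Bool) := by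
    intro y _; exact Fintype.mem_piFinset.2 fun _ => mem_univ _
  have h := card_biased_mul_le_log (fun _ : Option (Fin m) => (univ : Finset Bool)) (Yset.image indVec) hY
    (hne.image _) hε₁ (q := 2) (fun _ => by simp) B ?_
  · have hprod : (∏ _i : Option (Fin m), (((univ : Finset Bool)).card : ℝ)) = 2 ^ (m + 1) := by
      rw [prod_const, card_univ, Fintype.card_bool, card_univ, Fintype.card_option, Fintype.card_fin]
      norm_num
    rw [hprod, Real.log_pow, card_image_of_injective _ indVec_injective] at h
    push_cast at h
    linarith [h]
  · intro ℓ hℓ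
    have hF : ((Yset.image indVec).filter fun y => y ℓ = false).card = (Yset.filter fun J => ℓ ∉ J).card := by
      rw [card_filter_image_indVec]
      congr 1; ext J; simp
    have hT : ((Yset.image indVec).filter fun y => y ℓ = true).card = (Yset.filter fun J => ℓ ∈ J).card := by
      rw [card_filter_image_indVec]
      congr 1; ext J; simp
    have hcardY : ((Yset.image indVec).card : ℝ) = Yset.card := by
      rw [card_image_of_injective _ indVec_injective]
    have h2 : ((univ : Finset Bool).card : ℝ) = 2 := by simp
    rcases hB ℓ hℓ with (hb | hb) | (hb | hb)
    · exact ⟨false, mem_univ _, Or.inl (by rw [h2, hF, hcardY]; linarith)⟩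
    · exact ⟨false, mem_univ _, Or.inr (by rw [h2, hF, hcardY]; linarith)⟩
    · exact ⟨true, mem_univ _, Or.inl (by rw [h2, hT, hcardY]; linarith)⟩
    · exact ⟨true, mem_univ _, Or.inr (by rw [h2, hT, hcardY]; linarith)⟩

/-- **Unbiased ⇒ `U`-good** (contrapositive; Rothvoß: "it suffices to show that the number of
`ε`-biased indices is small"): if `A + C = Y > 0` and `¬(0 < A ≤ (1+ε)C ∧ C ≤ (1+ε)A)` with
`(1+ε₁)² ≤ 1+ε`, then the coordinate is `ε₁`-biased. [cite: Rothvoss2017, proof of Lemma 14 (PDF p. 12)] -/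
theorem biased_of_not_good {A C Y ε ε₁ : ℝ} (hY : Y = A + C) (hC0 : 0 ≤ C) (hYpos : 0 < Y)
    (hε₁ : 0 ≤ ε₁) (hε : (1 + ε₁) ^ 2 ≤ 1 + ε) (h : ¬(0 < A ∧ A ≤ (1 + ε) * C ∧ C ≤ (1 + ε) * A)) :
    ((1 + ε₁) * 2 * A < Y ∨ (1 + ε₁) * Y < 2 * A) ∨ ((1 + ε₁) * 2 * C < Y ∨ (1 + ε₁) * Y < 2 * C) := by
  by_contra hcon
  simp only [not_or, not_lt] at hcon
  obtain ⟨⟨h1, h2⟩, h3, h4⟩ := hcon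
  apply h
  refine ⟨?_, ?_, ?_⟩
  · nlinarith
  · have : 2 * A ≤ (1 + ε₁) * ((1 + ε₁) * 2 * C) := h2.trans (by nlinarith)
    nlinarith
  · have hA0 : 0 ≤ A := by nlinarith
    have : 2 * C ≤ (1 + ε₁) * ((1 + ε₁) * 2 * A) := h4.trans (by nlinarith)
    nlinarith

/-- `2^m ≤ (m+1) · binom(m, (m+1)/2)` for odd `m`. [folklore] -/
theorem two_pow_le_succ_mul_choose_half {m : ℕ} (hm : m % 2 = 1) :
    (2 : ℝ) ^ m ≤ (m + 1) * (m.choose ((m + 1) / 2) : ℝ) := by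
  obtain ⟨μ, rfl⟩ : ∃ μ, m = 2 * μ + 1 := ⟨m / 2, by omega⟩
  have h := two_pow_le_succ_mul_choose_middle μ
  have h1 : (2 * μ + 1 + 1) / 2 = μ + 1 := by omega
  rw [h1]
  have h2 : ((2 * μ + 1 : ℕ) : ℝ) + 1 = ((2 * μ + 2 : ℕ) : ℝ) := by push_cast; ring
  rw [h2]
  exact_mod_cast h

/-- The entropy constant of Lemma 14 (`ε₁ = 1/17`, `q = 2`). [folklore] -/
def cUbad : ℝ := ((1 / 17 : ℝ) / ((1 + 1 / 17) * 2)) ^ 2 / 2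

/-- `cUbad > 0`. [folklore] -/
theorem cUbad_pos : 0 < cUbad := by unfold cUbad; positivity

/-- `U`-goodness is decidable (classically). [folklore] -/
instance (X : Finset (Finset (Fin n))) (lab : Fin n → Lbl m) (t : ℕ) (H : Finset (Sym2 (Fin n))) (ε : ℝ) :
    Decidable (UGoodΩ X lab t H ε) := Classical.dec _

/-- `M`-goodness is decidable (classically). [folklore] -/
instance (Y : Finset (Finset (Sym2 (Fin n)))) (lab : Fin n → Lbl m) (H : Finset (Sym2 (Fin n))) (ε : ℝ) :
    Decidable (MGoodΩ Y lab H ε) := Classical.dec _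

variable {t : ℕ} {U₀ : Finset (Fin n)} {M₀ : Finset (Sym2 (Fin n))} {lab : Fin n → Lbl m}

/-- **Rothvoß's Lemma 14, for one family**: among the `(m+1)/2` partitions `swap_ℓ(T)`,
`ℓ ∈ Lout(T)`, at most a `1/16`-fraction is `U`-bad (not SMALL for `θ = 2^{-δm}` and not `U`-good
for `ε = 1/8`), once `m` is large and `δ` is small. [cite: Rothvoss2017, Lemma 14 (PDF pp. 11–12)] -/
theorem card_bad_family_le (h : lab ∈ Pfib n m k t U₀ M₀) (hk : 3 < k) (hm : m % 2 = 1)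
    (ht : t = (m + 1) / 2 * (k - 3) + 3) (X : Finset (Finset (Fin n))) (Y : Finset (Finset (Sym2 (Fin n))))
    {δ : ℝ} (hδ : δ * Real.log 2 ≤ cUbad / 64)
    (hm₀ : Real.log 2 + Real.log (m + 1) ≤ cUbad * (m + 1) / 64) :
    ((((Lout U₀ lab).filter fun ℓ₀ =>
        ¬SmallΩ X Y (swapO U₀ ℓ₀ lab) t (M₀.filter (IsCD lab)) ((2 : ℝ) ^ (-(δ * m))) ∧
          ¬UGoodΩ X (swapO U₀ ℓ₀ lab) t (M₀.filter (IsCD lab)) (1 / 8)).card : ℕ) : ℝ) ≤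
      1 / 16 * (Lout U₀ lab).card := by
  classical
  set θ : ℝ := (2 : ℝ) ^ (-(δ * m)) with hθ
  set HC := cov lab (M₀.filter (IsCD lab)) with hHC
  set Yset := (cubeIdx m).filter fun J => cubeU HC (famBlk U₀ lab) J ∈ X with hYset
  set Bset := (Lout U₀ lab).filter fun ℓ₀ =>
      ¬SmallΩ X Y (swapO U₀ ℓ₀ lab) t (M₀.filter (IsCD lab)) θ ∧
        ¬UGoodΩ X (swapO U₀ ℓ₀ lab) t (M₀.filter (IsCD lab)) (1 / 8) with hBset
  set N : ℕ := m.choose ((m + 1) / 2) with hN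
  have hθpos : 0 < θ := by positivity
  have hLout : ((Lout U₀ lab).card : ℝ) * 2 = m + 1 := by
    rw [card_Lout h hk hm ht]
    have : (m + 1) / 2 * 2 = m + 1 := by omega
    exact_mod_cast this
  -- the counts of a family member
  have hA : ∀ ℓ₀ ∈ Lout U₀ lab,
      ((X ∩ Uext (swapO U₀ ℓ₀ lab) t (M₀.filter (IsCD lab))).card : ℝ) = (Yset.filter fun J => ℓ₀ ∉ J).card :=
    fun ℓ₀ hℓ₀ => by rw [card_inter_Uext_swapO h hk ht hℓ₀ X]
  have hCc : ∀ ℓ₀ ∈ Lout U₀ lab,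
      ((X ∩ UextC (swapO U₀ ℓ₀ lab) t).card : ℝ) = (Yset.filter fun J => ℓ₀ ∈ J).card :=
    fun ℓ₀ hℓ₀ => by rw [card_inter_UextC_swapO h hk hm ht hℓ₀ X]
  have hUe : ∀ ℓ₀ ∈ Lout U₀ lab,
      ((Uext (swapO U₀ ℓ₀ lab) t (M₀.filter (IsCD lab))).card : ℝ) = N :=
    fun ℓ₀ hℓ₀ => by rw [card_Uext_swapO h hk ht hℓ₀]
  have hsplit : ∀ ℓ₀, (Yset.card : ℝ) = (Yset.filter fun J => ℓ₀ ∉ J).card + (Yset.filter fun J => ℓ₀ ∈ J).card := by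
    intro ℓ₀
    have := card_filter_add_card_filter_not (s := Yset) (fun J => ℓ₀ ∈ J)
    push_cast [← this]
    ring
  -- empty `Bset`: nothing to prove
  rcases Bset.eq_empty_or_nonempty with hB0 | ⟨ℓs, hℓs⟩
  · rw [hB0, card_empty]; push_cast; positivity
  -- a bad member is not small: `Yset` is large
  obtain ⟨hℓsL, hℓsS, -⟩ := mem_filter.1 hℓs
  have hbig : θ * N < Yset.card := by
    have h1 : ¬(((X ∩ Uext (swapO U₀ ℓs lab) t (M₀.filter (IsCD lab))).card : ℝ) ≤
        θ * (Uext (swapO U₀ ℓs lab) t (M₀.filter (IsCD lab))).card) := fun hle => hℓsS (Or.inr hle)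
    rw [not_le, hA ℓs hℓsL, hUe ℓs hℓsL] at h1
    have h2 : ((Yset.filter fun J => ℓs ∉ J).card : ℝ) ≤ Yset.card := by
      exact_mod_cast card_le_card (filter_subset _ _)
    linarith
  have hNpos : (0 : ℝ) < N := by
    rw [hN]; exact_mod_cast Nat.choose_pos (by omega)
  have hYpos : (0 : ℝ) < Yset.card := lt_of_le_of_lt (by positivity) hbig
  have hYne : Yset.Nonempty := by
    rw [← card_pos]; exact_mod_cast hYpos
  -- every bad member is biased
  have hbias := card_biased_cube_le Yset hYne (by norm_num : (0 : ℝ) < 1 / 17) Bset fun ℓ₀ hℓ₀ => by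
    obtain ⟨hℓ₀L, -, hℓ₀G⟩ := mem_filter.1 hℓ₀
    have hG' : ¬((0 : ℝ) < (Yset.filter fun J => ℓ₀ ∉ J).card ∧
        ((Yset.filter fun J => ℓ₀ ∉ J).card : ℝ) ≤ (1 + 1 / 8) * (Yset.filter fun J => ℓ₀ ∈ J).card ∧
        ((Yset.filter fun J => ℓ₀ ∈ J).card : ℝ) ≤ (1 + 1 / 8) * (Yset.filter fun J => ℓ₀ ∉ J).card) := by
      rintro ⟨h1, h2, h3⟩
      refine hℓ₀G ⟨?_, ?_, ?_⟩
      · rw [← hA ℓ₀ hℓ₀L] at h1; exact_mod_cast h1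
      · rw [hA ℓ₀ hℓ₀L, hCc ℓ₀ hℓ₀L]; exact h2
      · rw [hA ℓ₀ hℓ₀L, hCc ℓ₀ hℓ₀L]; exact h3
    exact biased_of_not_good (ε := 1 / 8) (ε₁ := 1 / 17) (hsplit ℓ₀) (Nat.cast_nonneg _) hYpos
      (by norm_num) (by norm_num) hG'
  -- the entropy deficit is small
  have hlogY : -(δ * m) * Real.log 2 + (m * Real.log 2 - Real.log (m + 1)) < Real.log Yset.card := by
    have h1 : Real.log (θ * N) < Real.log Yset.card := Real.log_lt_log (by positivity) hbig
    have h2 : Real.log (θ * N) = -(δ * m) * Real.log 2 + Real.log N := by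
      rw [Real.log_mul hθpos.ne' hNpos.ne', hθ, Real.log_rpow (by norm_num)]
    have h3 : m * Real.log 2 - Real.log (m + 1) ≤ Real.log N := by
      have h4 := two_pow_le_succ_mul_choose_half hm
      have h5 : Real.log ((2 : ℝ) ^ m) ≤ Real.log ((m + 1) * (N : ℝ)) := Real.log_le_log (by positivity) h4
      rw [Real.log_pow, Real.log_mul (by positivity) hNpos.ne'] at h5
      linarith
    linarith
  have hm1 : (0 : ℝ) ≤ m := Nat.cast_nonneg _
  have hkey : (Bset.card : ℝ) * cUbad ≤ Real.log 2 + Real.log (m + 1) + δ * m * Real.log 2 := by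
    have : (Bset.card : ℝ) * cUbad ≤ (m + 1) * Real.log 2 - Real.log Yset.card := hbias
    nlinarith
  have hB2 : (Bset.card : ℝ) * cUbad ≤ cUbad * (m + 1) / 64 + cUbad / 64 * m := by
    calc (Bset.card : ℝ) * cUbad ≤ Real.log 2 + Real.log (m + 1) + δ * m * Real.log 2 := hkey
      _ ≤ cUbad * (m + 1) / 64 + cUbad / 64 * m := by nlinarith
  have hB3 : (Bset.card : ℝ) ≤ (m + 1) / 64 + m / 64 :=
    le_of_mul_le_mul_right (by nlinarith [cUbad_pos]) cUbad_pos
  linarith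

end Entropy

/-! ### Double counting over the fibre -/

section DoubleCounting

variable {t : ℕ} {U₀ : Finset (Fin n)} {M₀ : Finset (Sym2 (Fin n))} {lab : Fin n → Lbl m}

/-- **`U`-bad partitions** of the fibre: not SMALL (for `θ`) and not `U`-good (for `ε`), the
`3`-matching being `H = M* ∩ (C × D)`. [cite: Rothvoss2017, §3.6 (PDF p. 11: "U-BAD(T,H) := ¬SMALL ∧ ¬U-GOOD")] -/
def UBadP (X : Finset (Finset (Fin n))) (Y : Finset (Finset (Sym2 (Fin n)))) (t : ℕ)
    (M₀ : Finset (Sym2 (Fin n))) (θ ε : ℝ) (lab : Fin n → Lbl m) : Prop :=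
  ¬SmallΩ X Y lab t (M₀.filter (IsCD lab)) θ ∧ ¬UGoodΩ X lab t (M₀.filter (IsCD lab)) ε

/-- `U`-badness is decidable (classically). [folklore] -/
instance (X : Finset (Finset (Fin n))) (Y : Finset (Finset (Sym2 (Fin n)))) (t : ℕ)
    (M₀ : Finset (Sym2 (Fin n))) (θ ε : ℝ) : DecidablePred (UBadP (m := m) X Y t M₀ θ ε) :=
  Classical.decPred _

/-- The `3`-matching of a family member is that of `T`. [folklore] -/
theorem filter_isCD_swapO (h : lab ∈ Pfib n m k t U₀ M₀) :
    ∀ ℓ : Option (Fin m), M₀.filter (IsCD (swapO U₀ ℓ lab)) = M₀.filter (IsCD lab)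
  | none => rfl
  | some _ => filter_isCD_swapLab h

/-- `U`-badness of a family member, with the `3`-matching of `T`. [folklore] -/
theorem uBadP_swapO_iff (h : lab ∈ Pfib n m k t U₀ M₀) {X : Finset (Finset (Fin n))}
    {Y : Finset (Finset (Sym2 (Fin n)))} {θ ε : ℝ} (ℓ : Option (Fin m)) :
    UBadP X Y t M₀ θ ε (swapO U₀ ℓ lab) ↔
      ¬SmallΩ X Y (swapO U₀ ℓ lab) t (M₀.filter (IsCD lab)) θ ∧
        ¬UGoodΩ X (swapO U₀ ℓ lab) t (M₀.filter (IsCD lab)) ε := by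
  rw [UBadP, filter_isCD_swapO h]

/-- **Double counting** (the printed "(m+1)-to-1 map", here via the involutions
`(T, ℓ) ↦ (swap_ℓ T, ℓ)`): summing over `T` the number of bad members of the family of `T` counts
every bad `T'` exactly `|Lout(T')| = (m+1)/2` times.
[cite: Rothvoss2017, proof of Lemma 14 (PDF p. 11: "an (m+1)-to-1 map … it suffices to show a certain property for the uniform random choice from T_1, …, T_{m+1}")] -/
theorem sum_card_bad_family_eq (hk : 3 < k) (hm : m % 2 = 1) (ht : t = (m + 1) / 2 * (k - 3) + 3)
    (Q : (Fin n → Lbl m) → Prop) [DecidablePred Q] :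
    ∑ lab ∈ Pfib n m k t U₀ M₀, ((Lout U₀ lab).filter fun ℓ => Q (swapO U₀ ℓ lab)).card =
      (m + 1) / 2 * ((Pfib n m k t U₀ M₀).filter Q).card := by
  classical
  -- both sides as cardinalities of sets of pairs `(T, ℓ)`
  rw [← card_sigma]
  have hR : (m + 1) / 2 * ((Pfib n m k t U₀ M₀).filter Q).card =
      ((Pfib n m k t U₀ M₀).sigma fun lab => (Lout U₀ lab).filter fun _ => Q lab).card := by
    rw [card_sigma]
    have : ∀ lab ∈ Pfib n m k t U₀ M₀, ((Lout U₀ lab).filter fun _ => Q lab).card =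
        if Q lab then (m + 1) / 2 else 0 := by
      intro lab hlab
      split_ifs with hQ
      · rw [filter_true_of_mem (fun _ _ => hQ), card_Lout hlab hk hm ht]
      · rw [filter_false_of_mem (fun _ _ => hQ), card_empty]
    rw [sum_congr rfl this, ← sum_filter, sum_const, smul_eq_mul, mul_comm]
  rw [hR]
  refine card_nbij' (fun σ => ⟨swapO U₀ σ.2 σ.1, σ.2⟩) (fun σ => ⟨swapO U₀ σ.2 σ.1, σ.2⟩)
    (fun σ hσ => ?_) (fun σ hσ => ?_) (fun σ _ => ?_) (fun σ _ => ?_)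
  · rw [mem_coe, mem_sigma, mem_filter] at hσ
    obtain ⟨hlab, hℓ, hQ⟩ := hσ
    rw [mem_coe, mem_sigma, mem_filter]
    exact ⟨swapO_mem_Pfib hlab hk.le hℓ, mem_Lout_swapO hℓ, hQ⟩
  · rw [mem_coe, mem_sigma, mem_filter] at hσ
    obtain ⟨hlab, hℓ, hQ⟩ := hσ
    rw [mem_coe, mem_sigma, mem_filter]
    refine ⟨swapO_mem_Pfib hlab hk.le hℓ, mem_Lout_swapO hℓ, ?_⟩
    simp only [swapO_swapO]
    exact hQ
  · simp only [swapO_swapO]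
  · simp only [swapO_swapO]

/-- **Rothvoß's Lemma 14** (fibre form): among the partitions compatible with `(U*, M*)`, at most
a `1/16`-fraction is `U`-bad (`θ = 2^{-δm}`, `ε = 1/8`), for `m` large and `δ` small.
[cite: Rothvoss2017, Lemma 14 (PDF pp. 11–12)] -/
theorem card_Pfib_ubad_le (hk : 3 < k) (hm : m % 2 = 1) (ht : t = (m + 1) / 2 * (k - 3) + 3)
    (X : Finset (Finset (Fin n))) (Y : Finset (Finset (Sym2 (Fin n)))) {δ : ℝ}
    (hδ : δ * Real.log 2 ≤ cUbad / 64) (hm₀ : Real.log 2 + Real.log (m + 1) ≤ cUbad * (m + 1) / 64) :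
    ((((Pfib n m k t U₀ M₀).filter (UBadP X Y t M₀ ((2 : ℝ) ^ (-(δ * m))) (1 / 8))).card : ℕ) : ℝ) ≤
      1 / 16 * (Pfib n m k t U₀ M₀).card := by
  classical
  have hDC := sum_card_bad_family_eq (U₀ := U₀) (M₀ := M₀) hk hm ht (UBadP X Y t M₀ ((2 : ℝ) ^ (-(δ * m))) (1 / 8))
  -- the left-hand side is at most `(1/16) Σ_T |Lout T| = (1/16) ((m+1)/2) |𝒫|`
  have hle : ((∑ lab ∈ Pfib n m k t U₀ M₀, ((Lout U₀ lab).filter fun ℓ =>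
      UBadP X Y t M₀ ((2 : ℝ) ^ (-(δ * m))) (1 / 8) (swapO U₀ ℓ lab)).card : ℕ) : ℝ) ≤
      1 / 16 * ((m + 1) / 2 : ℕ) * (Pfib n m k t U₀ M₀).card := by
    push_cast
    calc ∑ lab ∈ Pfib n m k t U₀ M₀, ((((Lout U₀ lab).filter fun ℓ =>
          UBadP X Y t M₀ ((2 : ℝ) ^ (-(δ * m))) (1 / 8) (swapO U₀ ℓ lab)).card : ℕ) : ℝ)
        ≤ ∑ lab ∈ Pfib n m k t U₀ M₀, (1 / 16 : ℝ) * (Lout U₀ lab).card := by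
          refine sum_le_sum fun lab hlab => ?_
          have hcongr : ((Lout U₀ lab).filter fun ℓ =>
              UBadP X Y t M₀ ((2 : ℝ) ^ (-(δ * m))) (1 / 8) (swapO U₀ ℓ lab)) =
              (Lout U₀ lab).filter fun ℓ =>
                ¬SmallΩ X Y (swapO U₀ ℓ lab) t (M₀.filter (IsCD lab)) ((2 : ℝ) ^ (-(δ * m))) ∧
                  ¬UGoodΩ X (swapO U₀ ℓ lab) t (M₀.filter (IsCD lab)) (1 / 8) :=
            filter_congr fun ℓ _ => uBadP_swapO_iff hlab ℓ
          rw [hcongr]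
          exact card_bad_family_le hlab hk hm ht X Y hδ hm₀
      _ = 1 / 16 * ((m + 1) / 2 : ℕ) * (Pfib n m k t U₀ M₀).card := by
          rw [← mul_sum, sum_congr rfl fun lab hlab => by rw [card_Lout hlab hk hm ht], sum_const,
            nsmul_eq_mul]
          ring
  rw [hDC] at hle
  push_cast at hle
  have hpos : (0 : ℝ) < ((m + 1) / 2 : ℕ) := by
    have : 0 < (m + 1) / 2 := by omega
    exact_mod_cast this
  nlinarith

end DoubleCounting

end Literature.Barriers.PneNP
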